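import Mathlib
import HarnessLib
import Literature.Analysis.FluidPDE.ClassicalSolution
import Literature.Analysis.FluidPDE.LerayHopf
import Literature.Analysis.FluidPDE.NSLerayBlowupRateEnstrophy
import Literature.Analysis.FluidPDE.TaoLocalisationHolds
import Literature.Analysis.FluidPDE.NSCriticalClosureBesovBounded
import Summits.NavierStokesRegularity.NavierStokesRegularity.Theses.QuarterJolt
import Summits.NavierStokesRegularity.NavierStokesRegularity.Theorems.QuarterJoltEnergyJumpLaw
import Summits.NavierStokesRegularity.NavierStokesRegularity.Theorems.CertifiedBlowupCertifiedBlowupAxisymBlowupEnergyDrain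

/-!
# Route QuarterJolt — crux `NoTerminalJolt` (stmt-NavierStokesRegularity-26463), LEAD line
# `regular_split` rev 4: the TERMINAL PAIRING LAW — at a first blow-up time the energy drop is
# self-similar-sized, so «no terminal jolt» is a CANCELLATION law for the pairing `⟪u(t), u(T)⟫`

Seat ns-ntj-p1 g3 (LEAD of the crux; `--supports 26463 --as helper`), sequel of
`QuarterJoltEnergyJumpLaw.lean` / `QuarterJoltEnergyJumpDefect.lean`. Frame of the crux at a FIRST
BLOW-UP time: `(u,p)` a MAXIMAL classical solution on `[0,T)` (`IsMaximalSmoothSolution`), Leray–Hopf on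
`[0,T]` from a rapidly decaying datum. Write `drop(t) = ∫‖u(t)‖² − ∫‖u(T)‖²` (energy drop to the
terminal value), `pair(t) = ∫⟪u(t) − u(T), u(T)⟫` (pairing excess over the terminal value; `→ 0` by weak
continuity) and `D(t) = (√(T−t))⁻¹ ∫‖u(t) − u(T)‖²` (the jolt functional of the crux).

* `joltFunctional_eq_drop_sub_pair` — the identity `∫‖u(t) − u(T)‖² = drop(t) − 2·pair(t)`
  (`integral_norm_sub_sq_terminal_eq`), hence `pair(t) ≤ ½ drop(t)`.
* `lerayRate_of_frame` — LERAY'S ENSTROPHY RATE in the frame, no symmetry: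
  `c ν^{3/2}/√(T−t) ≤ ∫|∇u(t)|²_F` on `[0,T)` (tree: `leray_blowup_rate_enstrophy`, Leray 1934 §20 /
  RRS 2016 Lemma 6.13, fed with boundedness on closed sub-slabs from Tao 2013 Cor. 11.1,
  `exists_forall_norm_le_of_tao2011` + `tao2011_hasBoundedSobolevNormsOn_holds`).
* `energyDrop_ge_sqrt` — **THE ENERGY DROP IS SELF-SIMILAR-SIZED**: one universal `c > 0` with
  `4c ν^{5/2} √(T−t) ≤ ∫‖u(t)‖² − ∫‖u(T)‖²` for every `t ∈ [0,T)` of every frame solution at a first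
  blow-up time `T` (the energy drain law `EnergyDrain.energy_sub_terminal_ge_of_rate` of the tree — there
  stated for axisymmetric witnesses — in the plain frame). So the ENERGY-DROP functional
  `drop(t)/√(T−t)` NEVER tends to `0` at a blow-up time, whereas the crux asks the DISTANCE functional
  `D(t) = (drop(t) − 2 pair(t))/√(T−t)` to tend to `0`:
* `terminalPairingLaw` — **no terminal jolt at a first blow-up time forces
  `pair(t) ≥ (2cν^{5/2} − ε)√(T−t)` eventually, for every `ε > 0`**: the trajectory must approach its
  terminal value with a POSITIVE pairing excess `⟪u(t), u(T)⟫ − ‖u(T)‖² ≍ √(T−t)` that cancels the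
  energy drop to `o(√(T−t))`. Contrapositives for the disprover: `jolt_of_pair_le` (a first blow-up
  whose pairing excess stays `≤ cν^{5/2}√(T−t)` JOLTS), `jolt_of_integral_inner_le` (a first blow-up
  whose trajectory satisfies `∫⟪u(t), u(T)⟫ ≤ ∫‖u(T)‖²` near `T` — e.g. an EXTINCT terminal value
  `u(T) = 0`, `jolt_of_terminalValue_eq_zero` — JOLTS).

HONEST FRAMING: a priori laws about a HYPOTHETICAL first blow-up in the frame; nothing here proves
`NoTerminalJolt`, excludes blow-up, or proves Navier–Stokes regularity. No summit statement is proved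
here. [folklore]

## References
* J. Leray, Acta Math. 63 (1934), §20 (3.14), §31. [Leray1934]
* J. C. Robinson, J. L. Rodrigo, W. Sadowski, CUP 2016, Lemma 6.13, Cor. 6.25. [RobinsonRodrigoSadowski2016]
* T. Tao, Anal. PDE 6 (2013), Cor. 11.1. [Tao2011]
-/

noncomputable section

-- the summit and its single sub-problem share the name (CONVENTIONS §1), as in every Theorems file
set_option linter.dupNamespace false

namespace Summit.NavierStokesRegularity.NavierStokesRegularity.Theorems

open MeasureTheory Set Function Filter Topology
open scoped NNReal ENNReal InnerProductSpace RealInnerProductSpace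
open Literature.Analysis.FluidPDE

namespace NoTerminalJolt

/-! ### The jolt functional = (energy drop − 2 · pairing excess)/√(T−t) -/

/-- **`∫‖u(t) − u(T)‖² = drop(t) − 2·pair(t)`**: for a Leray–Hopf solution on `[0,T]` and `t ∈ [0,T]`,
`∫‖u(t) − u(T)‖² = (∫‖u(t)‖² − ∫‖u(T)‖²) − 2∫⟪u(t) − u(T), u(T)⟫`. [folklore] -/
theorem integral_norm_sub_sq_eq_drop_sub_pair {ν T : ℝ} (hT : 0 < T)
    {f : ℝ → EuclideanSpace ℝ (Fin 3) → EuclideanSpace ℝ (Fin 3)}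
    {u₀ : EuclideanSpace ℝ (Fin 3) → EuclideanSpace ℝ (Fin 3)}
    {u : ℝ → EuclideanSpace ℝ (Fin 3) → EuclideanSpace ℝ (Fin 3)} (hLH : IsLerayHopfOn T ν f u₀ u)
    {t : ℝ} (ht : t ∈ Icc 0 T) :
    ∫ x, ‖u t x - u T x‖ ^ 2 =
      ((∫ x, ‖u t x‖ ^ 2) - ∫ x, ‖u T x‖ ^ 2) - 2 * ∫ x, ⟪u t x - u T x, u T x⟫ := by
  have hmt : MemLp (u t) 2 volume := hLH.memLp t ht
  have hmT : MemLp (u T) 2 volume := hLH.memLp T ⟨hT.le, le_rfl⟩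
  have hpair : ∫ x, ⟪u t x - u T x, u T x⟫ = (∫ x, ⟪u t x, u T x⟫) - ∫ x, ‖u T x‖ ^ 2 := by
    rw [← integral_sub (integrable_inner_of_memLp_two hmt hmT) (hmT.integrable_norm_pow two_ne_zero)]
    refine integral_congr_ae (Eventually.of_forall fun x => ?_)
    simp only [inner_sub_left, real_inner_self_eq_norm_sq]
  rw [integral_norm_sub_sq_terminal_eq hT hLH ht, hpair]
  ring

/-- Hence the pairing excess is at most half the energy drop: `∫⟪u(t) − u(T), u(T)⟫ ≤ ½(∫‖u(t)‖² − ∫‖u(T)‖²)`.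
[folklore] -/
theorem pair_le_half_drop {ν T : ℝ} (hT : 0 < T)
    {f : ℝ → EuclideanSpace ℝ (Fin 3) → EuclideanSpace ℝ (Fin 3)}
    {u₀ : EuclideanSpace ℝ (Fin 3) → EuclideanSpace ℝ (Fin 3)}
    {u : ℝ → EuclideanSpace ℝ (Fin 3) → EuclideanSpace ℝ (Fin 3)} (hLH : IsLerayHopfOn T ν f u₀ u)
    {t : ℝ} (ht : t ∈ Icc 0 T) :
    ∫ x, ⟪u t x - u T x, u T x⟫ ≤ ((∫ x, ‖u t x‖ ^ 2) - ∫ x, ‖u T x‖ ^ 2) / 2 := by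
  have h := integral_norm_sub_sq_eq_drop_sub_pair hT hLH ht
  have h0 : 0 ≤ ∫ x, ‖u t x - u T x‖ ^ 2 := integral_nonneg fun _ => sq_nonneg _
  linarith

/-! ### Leray's enstrophy rate and the energy drain in the frame (no symmetry) -/

/-- **Leray's enstrophy rate in the frame** (no symmetry hypothesis): there is a universal `c > 0` such
that every MAXIMAL classical solution on `[0,T)`, Leray–Hopf on `[0,T]` from a rapidly decaying datum,
has `c ν^{3/2}/√(T−t) ≤ ∫|∇u(t)|²_F` for every `t ∈ [0,T)` (tree theorem `leray_blowup_rate_enstrophy`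
with the boundedness on closed sub-slabs of Tao 2013 Cor. 11.1, `exists_forall_norm_le_of_tao2011`).
[cite: Leray1934, §20 (3.14)] [cite: RobinsonRodrigoSadowski2016, Lemma 6.13] -/
theorem lerayRate_of_frame : ∃ c : ℝ, 0 < c ∧ ∀ {ν T : ℝ}
    {u : ℝ → EuclideanSpace ℝ (Fin 3) → EuclideanSpace ℝ (Fin 3)} {p : ℝ → EuclideanSpace ℝ (Fin 3) → ℝ},
    0 < ν → 0 < T → IsMaximalSmoothSolution ν 0 u p T → IsLerayHopfOn T ν 0 (u 0) u →
    HasRapidSpatialDecay (u 0) → ∀ t ∈ Ico 0 T,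
      ENNReal.ofReal (c * ν ^ (3 / 2 : ℝ) / Real.sqrt (T - t)) ≤
        ∫⁻ x, ENNReal.ofReal (frobeniusNormSq (fderiv ℝ (u t) x)) := by
  obtain ⟨c, hc, hrate⟩ := leray_blowup_rate_enstrophy
  refine ⟨c, hc, fun {ν T u p} hν hT hmax hLH hdec t ht => ?_⟩
  -- boundedness on closed sub-slabs (Tao 2013 Cor. 11.1 + Sobolev, tree: `exists_forall_norm_le_of_tao2011`;
  -- the `L^∞` packaging is the landed `L3TimeExponentPincerStubParabolicConcentration.eLpNorm_top_Icc_lt_top_of_frame`,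
  -- re-derived inline here to keep this file out of that route's import cone)
  have hbd : ∀ T' ∈ Ioo 0 T, eLpNorm (uncurry u) ∞ (volume.restrict (Icc 0 T' ×ˢ univ)) < ∞ := by
    intro T' hT'
    obtain ⟨M, hM⟩ := exists_forall_norm_le_of_tao2011 tao2011_hasBoundedSobolevNormsOn_holds hν hmax.1
      hLH hdec T' hT'
    rw [eLpNorm_exponent_top]
    exact eLpNormEssSup_lt_top_of_ae_bound (C := M)
      ((ae_restrict_mem (measurableSet_Icc.prod MeasurableSet.univ)).mono fun z hz => hM z.1 hz.1 z.2)
  have h := hrate ν T hν hT u p hmax hLH hbd t ht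
  have hTt : 0 < T - t := sub_pos.2 ht.2
  have heq : c * ν ^ (3 / 2 : ℝ) * (T - t) ^ (-(1 / 2 : ℝ)) = c * ν ^ (3 / 2 : ℝ) / Real.sqrt (T - t) := by
    rw [Real.rpow_neg hTt.le, ← Real.sqrt_eq_rpow]
    ring
  rwa [heq] at h

/-- **THE ENERGY DROP IS SELF-SIMILAR-SIZED at a first blow-up time.** There is a universal `c > 0`
such that every maximal classical solution on `[0,T)` (`ν, T > 0`), Leray–Hopf on `[0,T]` from a rapidly
decaying datum, satisfies `4c ν^{5/2} √(T−t) ≤ ∫‖u(t)‖² − ∫‖u(T)‖²` for every `t ∈ [0,T)` — the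
tree's energy drain law (`EnergyDrain.energy_sub_terminal_ge_of_rate`) fed with Leray's rate in the
frame. Consequently the energy-drop functional `(√(T−t))⁻¹(∫‖u(t)‖² − ∫‖u(T)‖²)` is `≥ 4cν^{5/2}` and
never tends to `0` at a first blow-up time. [cite: Leray1934, §20 (3.14) and §31 (5.2)] -/
theorem energyDrop_ge_sqrt : ∃ c : ℝ, 0 < c ∧ ∀ {ν T : ℝ}
    {u : ℝ → EuclideanSpace ℝ (Fin 3) → EuclideanSpace ℝ (Fin 3)} {p : ℝ → EuclideanSpace ℝ (Fin 3) → ℝ},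
    0 < ν → 0 < T → IsMaximalSmoothSolution ν 0 u p T → IsLerayHopfOn T ν 0 (u 0) u →
    HasRapidSpatialDecay (u 0) → ∀ t ∈ Ico 0 T,
      4 * c * ν ^ (5 / 2 : ℝ) * Real.sqrt (T - t) ≤ (∫ x, ‖u t x‖ ^ 2) - ∫ x, ‖u T x‖ ^ 2 := by
  obtain ⟨c, hc, hrate⟩ := lerayRate_of_frame
  refine ⟨c, hc, fun {ν T u p} hν hT hmax hLH hdec t ht => ?_⟩
  have h := CertifiedBlowupAxisymBlowup.EnergyDrain.energy_sub_terminal_ge_of_rate hν hmax.1 hLH hc.le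
    (hrate hν hT hmax hLH hdec) ht
  have h2t : ∫ x, ‖u t x‖ ^ 2 = 2 * VectorCalculus.kineticEnergy (u t) := by
    simp only [VectorCalculus.kineticEnergy]; ring
  have h2T : ∫ x, ‖u T x‖ ^ 2 = 2 * VectorCalculus.kineticEnergy (u T) := by
    simp only [VectorCalculus.kineticEnergy]; ring
  rw [h2t, h2T]
  linarith

/-! ### The terminal pairing law -/

/-- **THE TERMINAL PAIRING LAW.** With the universal constant `c > 0` of `energyDrop_ge_sqrt`: if a
maximal classical solution on `[0,T)` (`ν, T > 0`), Leray–Hopf on `[0,T]` from a rapidly decaying datum,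
has NO terminal jolt at its blow-up time `T` (`(√(T−t))⁻¹ ∫‖u(t) − u(T)‖² → 0`), then for every `ε > 0`,
eventually as `t ↑ T`: `(2cν^{5/2} − ε) √(T−t) ≤ ∫⟪u(t) − u(T), u(T)⟫` — the pairing excess over the
terminal value is POSITIVE of self-similar size and cancels the energy drop:
`∫‖u(t) − u(T)‖² = drop(t) − 2 pair(t) = o(√(T−t))` with `drop(t) ≥ 4cν^{5/2}√(T−t)`. [folklore] -/
theorem terminalPairingLaw : ∃ c : ℝ, 0 < c ∧ ∀ {ν T : ℝ}
    {u : ℝ → EuclideanSpace ℝ (Fin 3) → EuclideanSpace ℝ (Fin 3)} {p : ℝ → EuclideanSpace ℝ (Fin 3) → ℝ},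
    0 < ν → 0 < T → IsMaximalSmoothSolution ν 0 u p T → IsLerayHopfOn T ν 0 (u 0) u →
    HasRapidSpatialDecay (u 0) →
    Tendsto (fun t : ℝ => (Real.sqrt (T - t))⁻¹ * ∫ x, ‖u t x - u T x‖ ^ 2) (𝓝[<] T) (𝓝 0) →
    ∀ ε : ℝ, 0 < ε → ∀ᶠ t in 𝓝[<] T,
      (2 * c * ν ^ (5 / 2 : ℝ) - ε) * Real.sqrt (T - t) ≤ ∫ x, ⟪u t x - u T x, u T x⟫ := by
  obtain ⟨c, hc, hdrop⟩ := energyDrop_ge_sqrt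
  refine ⟨c, hc, fun {ν T u p} hν hT hmax hLH hdec hJ ε hε => ?_⟩
  -- eventually `D(t) < 2ε`, i.e. `∫‖u t − u T‖² < 2ε √(T−t)`
  have hev : ∀ᶠ t in 𝓝[<] T, (Real.sqrt (T - t))⁻¹ * ∫ x, ‖u t x - u T x‖ ^ 2 < 2 * ε :=
    hJ.eventually (Iio_mem_nhds (by linarith))
  filter_upwards [hev, Ioo_mem_nhdsLT hT] with t hDt ht
  have hsq : 0 < Real.sqrt (T - t) := Real.sqrt_pos.2 (sub_pos.2 ht.2)
  have hdist : ∫ x, ‖u t x - u T x‖ ^ 2 < 2 * ε * Real.sqrt (T - t) := by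
    have h := (inv_mul_lt_iff₀ hsq).1 hDt
    linarith [h]
  have hid := integral_norm_sub_sq_eq_drop_sub_pair hT hLH ⟨ht.1.le, ht.2.le⟩
  have hd := hdrop hν hT hmax hLH hdec t ⟨ht.1.le, ht.2⟩
  nlinarith

/-- **Contrapositive for the disprover: a first blow-up with small pairing excess JOLTS.** With the
constant `c` of `terminalPairingLaw`: if eventually `∫⟪u(t) − u(T), u(T)⟫ ≤ cν^{5/2}√(T−t)`, the jolt
functional does not tend to `0`. [folklore] -/
theorem jolt_of_pair_le : ∃ c : ℝ, 0 < c ∧ ∀ {ν T : ℝ}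
    {u : ℝ → EuclideanSpace ℝ (Fin 3) → EuclideanSpace ℝ (Fin 3)} {p : ℝ → EuclideanSpace ℝ (Fin 3) → ℝ},
    0 < ν → 0 < T → IsMaximalSmoothSolution ν 0 u p T → IsLerayHopfOn T ν 0 (u 0) u →
    HasRapidSpatialDecay (u 0) →
    (∀ᶠ t in 𝓝[<] T, ∫ x, ⟪u t x - u T x, u T x⟫ ≤ c * ν ^ (5 / 2 : ℝ) * Real.sqrt (T - t)) →
    ¬ Tendsto (fun t : ℝ => (Real.sqrt (T - t))⁻¹ * ∫ x, ‖u t x - u T x‖ ^ 2) (𝓝[<] T) (𝓝 0) := by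
  obtain ⟨c, hc, hlaw⟩ := terminalPairingLaw
  refine ⟨c, hc, fun {ν T u p} hν hT hmax hLH hdec hsmall hJ => ?_⟩
  have hcν : 0 < c * ν ^ (5 / 2 : ℝ) := by positivity
  have hev := hlaw hν hT hmax hLH hdec hJ (c * ν ^ (5 / 2 : ℝ) / 2) (by positivity)
  obtain ⟨t, h1, h2, ht⟩ := (hev.and (hsmall.and (Ioo_mem_nhdsLT hT))).exists
  have hsq : 0 < Real.sqrt (T - t) := Real.sqrt_pos.2 (sub_pos.2 ht.2)
  nlinarith

/-- **A first blow-up whose trajectory does not overshoot its terminal value in the pairing JOLTS**: if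
eventually `∫⟪u(t), u(T)⟫ ≤ ∫‖u(T)‖²` (pairing excess `≤ 0`), the jolt functional does not tend to `0`.
[folklore] -/
theorem jolt_of_integral_inner_le {ν T : ℝ} (hν : 0 < ν) (hT : 0 < T)
    {u : ℝ → EuclideanSpace ℝ (Fin 3) → EuclideanSpace ℝ (Fin 3)}
    {p : ℝ → EuclideanSpace ℝ (Fin 3) → ℝ}
    (hmax : IsMaximalSmoothSolution ν 0 u p T) (hLH : IsLerayHopfOn T ν 0 (u 0) u)
    (hdec : HasRapidSpatialDecay (u 0))
    (hle : ∀ᶠ t in 𝓝[<] T, ∫ x, ⟪u t x, u T x⟫ ≤ ∫ x, ‖u T x‖ ^ 2) :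
    ¬ Tendsto (fun t : ℝ => (Real.sqrt (T - t))⁻¹ * ∫ x, ‖u t x - u T x‖ ^ 2) (𝓝[<] T) (𝓝 0) := by
  obtain ⟨c, hc, hj⟩ := jolt_of_pair_le
  refine hj hν hT hmax hLH hdec ?_
  have hmT : MemLp (u T) 2 volume := hLH.memLp T ⟨hT.le, le_rfl⟩
  filter_upwards [hle, Ioo_mem_nhdsLT hT] with t ht htI
  have hmt : MemLp (u t) 2 volume := hLH.memLp t ⟨htI.1.le, htI.2.le⟩
  have hpair : ∫ x, ⟪u t x - u T x, u T x⟫ = (∫ x, ⟪u t x, u T x⟫) - ∫ x, ‖u T x‖ ^ 2 := by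
    rw [← integral_sub (integrable_inner_of_memLp_two hmt hmT) (hmT.integrable_norm_pow two_ne_zero)]
    refine integral_congr_ae (Eventually.of_forall fun x => ?_)
    simp only [inner_sub_left, real_inner_self_eq_norm_sq]
  rw [hpair]
  have h0 : 0 ≤ c * ν ^ (5 / 2 : ℝ) * Real.sqrt (T - t) := by positivity
  linarith

/-- **Total extinction at a first blow-up time JOLTS**: if the Leray–Hopf terminal value vanishes,
`u(T) = 0`, then `(√(T−t))⁻¹ ∫‖u(t) − u(T)‖² = (√(T−t))⁻¹ ∫‖u(t)‖² ≥ 4cν^{5/2}` does not tend to `0`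
(the extinct caricatures of `QuarterJoltRung` / `QuarterJoltRateCaricature` are thus faithful to the
frame only in their Type-I-rate, jolting members). [folklore] -/
theorem jolt_of_terminalValue_eq_zero {ν T : ℝ} (hν : 0 < ν) (hT : 0 < T)
    {u : ℝ → EuclideanSpace ℝ (Fin 3) → EuclideanSpace ℝ (Fin 3)}
    {p : ℝ → EuclideanSpace ℝ (Fin 3) → ℝ}
    (hmax : IsMaximalSmoothSolution ν 0 u p T) (hLH : IsLerayHopfOn T ν 0 (u 0) u)
    (hdec : HasRapidSpatialDecay (u 0)) (hzero : u T = 0) :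
    ¬ Tendsto (fun t : ℝ => (Real.sqrt (T - t))⁻¹ * ∫ x, ‖u t x - u T x‖ ^ 2) (𝓝[<] T) (𝓝 0) :=
  jolt_of_integral_inner_le hν hT hmax hLH hdec (Eventually.of_forall fun t => by simp [hzero])

end NoTerminalJolt

end Summit.NavierStokesRegularity.NavierStokesRegularity.Theorems

end
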